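import Summits.ValiantsHypothesis.ValiantsHypothesis.Theorems.FifoMatchingNNDivisionHardMaxCutLPKMR

/-!
# FifoMatching · NNDivisionHard — MAX-CUT LP classes, part 3/4: §6⁰ LP duality on a slack-form lift (`affine_farkas`), §6a–§6c the dictionary to the tree's KMR theorem ⇒ ★ `KMR.maxCutLPGapHard_holds`

Theorems-grade port (bytes staged by val-idea-43 g5 for a port hand) of §3g `…Cruxes.NNDivisionHard.VirtualPassenger.MaxCutLP43` of the
registered LINE `Cruxes/NNDivisionHard/Lines/virtual_passenger.lean` rev 18 @21a5fb60d209 (pen val-idea-42 g2), lines 977–1784 — statements and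
proofs VERBATIM (author of the block: val-idea-43 g2/g3, card `maxcut-relaxation`, kernel `MaxCutLPSketch.lean` rev 3.3; pen intakes rev 9 / 13 / 15);
edits: namespace `…Theorems.FifoMatching.MaxCutLP`, `T` a local abbrev δ-equal to `XcDivision.T`, 30 helper docstrings, split in four parts for
the 400-line cap.  Purpose: free ≈ 46 KB of the line's 200 KB workfile budget (pen's BYTES NOTE 2026-08-28T23:26:44Z); after landing the line
replaces §3g by `import` + `open …MaxCutLP` (names unchanged below the namespace).
-/

set_option linter.dupNamespace false

namespace Summit.ValiantsHypothesis.ValiantsHypothesis.Theorems.FifoMatching.MaxCutLP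

open Matrix Finset
open scoped Pointwise
open Literature.Barriers.PneNP (HasEFOfSize)
open Literature.Combinatorics.Optimization (corPolytopeGraph corVec)

variable {h : ℕ}

open Filter Topology

/-! ## §6 (REV 3, val-idea-43 g3) P1 PAID UNCONDITIONALLY: `KMR.MaxCutLPGapHard` IS A THEOREM OF THE TREE val-lit- … ⟨abr.⟩ -/

section Unconditional

open Literature.Combinatorics.Optimization (CSPInstance CSPConstraint maxCutPreds
  KothariMekaRaghavendra2017_cor15_maxCut_holds)
open Literature.Barriers.PneNP (ExtendedFormulation)


/-! ### §6⁰ LP duality on a slack-form lift (g0's `VirtualXc.affineRowCertificateComplete_holds`, INLINED so that … ⟨abr.⟩ -/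

/-- a valid inequality `0 ≤ c + ⟨yrow, u⟩` on the NONEMPTY projection `QQ.projSet = {u | ∃ v ≥ 0, E u + F v = g}` … ⟨abr.⟩ -/
theorem liftCertificate {ι : Type} [Fintype ι] {s : ℕ} (QQ : ExtendedFormulation ι s) (yrow : ι → ℝ) (c : ℝ)
    (hne : QQ.projSet.Nonempty) (hval : ∀ u ∈ QQ.projSet, 0 ≤ c + yrow ⬝ᵥ u) :
    ∃ μ : Fin QQ.k → ℝ, yrow = μ ᵥ* QQ.E ∧ (∀ i, (μ ᵥ* QQ.F) i ≤ 0) ∧ 0 ≤ μ ⬝ᵥ QQ.g + c := by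
  classical
  -- rows: (E-rows ≤) ⊕ (E-rows ≥, written as −… ≤ −g) ⊕ (−v ≤ 0); columns: u-coordinates ⊕ v-coordinates
  let A : Matrix ((Fin QQ.k ⊕ Fin QQ.k) ⊕ Fin s) (ι ⊕ Fin s) ℝ := Matrix.of fun i j =>
    match i with
    | Sum.inl (Sum.inl i') => Sum.elim (fun j' => QQ.E i' j') (fun j' => QQ.F i' j') j
    | Sum.inl (Sum.inr i') => - Sum.elim (fun j' => QQ.E i' j') (fun j' => QQ.F i' j') j
    | Sum.inr i' => Sum.elim (fun _ => (0 : ℝ)) (fun j' => if j' = i' then (-1 : ℝ) else 0) j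
  let b : ((Fin QQ.k ⊕ Fin QQ.k) ⊕ Fin s) → ℝ := Sum.elim (Sum.elim QQ.g (-QQ.g)) (fun _ => 0)
  let cc : ι ⊕ Fin s → ℝ := Sum.elim (-yrow) (fun _ => 0)
  -- evaluation of the three row blocks
  have hrow1 : ∀ z : ι ⊕ Fin s → ℝ, ∀ i' : Fin QQ.k,
      (A *ᵥ z) (Sum.inl (Sum.inl i')) = (QQ.E *ᵥ (fun j => z (Sum.inl j)) + QQ.F *ᵥ (fun j => z (Sum.inr j))) i' := by
    intro z i'
    simp [A, Matrix.mulVec, dotProduct, Fintype.sum_sum_type, Matrix.of_apply]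
  have hrow2 : ∀ z : ι ⊕ Fin s → ℝ, ∀ i' : Fin QQ.k,
      (A *ᵥ z) (Sum.inl (Sum.inr i')) = - (QQ.E *ᵥ (fun j => z (Sum.inl j)) + QQ.F *ᵥ (fun j => z (Sum.inr j))) i' := by
    intro z i'
    simp [A, Matrix.mulVec, dotProduct, Fintype.sum_sum_type, Matrix.of_apply, Finset.sum_neg_distrib]
  have hrow3 : ∀ z : ι ⊕ Fin s → ℝ, ∀ i' : Fin s, (A *ᵥ z) (Sum.inr i') = - z (Sum.inr i') := by
    intro z i'
    simp [A, Matrix.mulVec, dotProduct, Fintype.sum_sum_type, Matrix.of_apply]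
  -- A z ≤ b ↔ lifted feasibility
  have hAz : ∀ z : ι ⊕ Fin s → ℝ, A *ᵥ z ≤ b ↔
      (QQ.E *ᵥ (fun j => z (Sum.inl j)) + QQ.F *ᵥ (fun j => z (Sum.inr j)) = QQ.g ∧ ∀ j, 0 ≤ z (Sum.inr j)) := by
    intro z
    constructor
    · intro h
      refine ⟨?_, ?_⟩
      · funext i'
        have h1 := h (Sum.inl (Sum.inl i'))
        have h2 := h (Sum.inl (Sum.inr i'))
        rw [hrow1] at h1
        rw [hrow2] at h2
        simp [b] at h1 h2
        rw [Pi.add_apply]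
        linarith
      · intro j
        have h3 := h (Sum.inr j)
        rw [hrow3] at h3
        simp [b] at h3
        linarith
    · rintro ⟨heq, hv⟩ i
      rcases i with (i' | i') | i'
      · rw [hrow1, heq]; simp [b]
      · rw [hrow2, heq]; simp [b]
      · rw [hrow3]; simp [b]; linarith [hv i']
  -- feasibility and validity of `cc ⬝ᵥ z ≤ c`
  have hP : ∃ z : ι ⊕ Fin s → ℝ, A *ᵥ z ≤ b := by
    obtain ⟨u, v, hv, huv⟩ := hne
    refine ⟨Sum.elim u v, (hAz _).mpr ⟨?_, fun j => by simpa using hv j⟩⟩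
    simpa using huv
  have hcc : ∀ z : ι ⊕ Fin s → ℝ, cc ⬝ᵥ z = - (yrow ⬝ᵥ fun j => z (Sum.inl j)) := by
    intro z
    simp [cc, dotProduct, Fintype.sum_sum_type, Finset.sum_neg_distrib]
  have hδ : ∀ z : ι ⊕ Fin s → ℝ, A *ᵥ z ≤ b → cc ⬝ᵥ z ≤ c := by
    intro z hz
    obtain ⟨heq, hv⟩ := (hAz z).mp hz
    have hu : (fun j => z (Sum.inl j)) ∈ QQ.projSet := ⟨fun j => z (Sum.inr j), hv, heq⟩
    have := hval _ hu
    rw [hcc]; linarith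
  obtain ⟨y, hy, hyA, hyb⟩ := Literature.Analysis.Convex.LPDuality.affine_farkas A b cc hP hδ
  -- read off the multipliers
  refine ⟨fun i' => y (Sum.inl (Sum.inr i')) - y (Sum.inl (Sum.inl i')), ?_, ?_, ?_⟩
  · funext j'
    have h := congr_fun hyA (Sum.inl j')
    simp [A, cc, Matrix.vecMul, dotProduct, Fintype.sum_sum_type, Matrix.of_apply] at h
    simp [Matrix.vecMul, dotProduct, sub_mul, Finset.sum_sub_distrib]
    linarith
  · intro j'
    have h := congr_fun hyA (Sum.inr j')
    simp [A, cc, Matrix.vecMul, dotProduct, Fintype.sum_sum_type, Matrix.of_apply] at h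
    have hy3 : 0 ≤ y (Sum.inr j') := hy (Sum.inr j')
    simp [Matrix.vecMul, dotProduct, sub_mul, Finset.sum_sub_distrib]
    linarith
  · have h := hyb
    simp [b, dotProduct, Fintype.sum_sum_type, Finset.sum_neg_distrib] at h
    simp [dotProduct, sub_mul, Finset.sum_sub_distrib]
    linarith

namespace KMR

/-! ### §6a the dictionary: tree MAX-CUT instances ↦ nonnegative weightings -/

/-- a binary-disequality constraint is satisfied iff its two variables get different values. -/
theorem sat_eq_bne {n : ℕ} (C : CSPConstraint 2 n maxCutPreds) (b : Fin n → Bool) :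
    C.sat b = (b (C.idx 0) != b (C.idx 1)) := by
  have h : C.pred = fun y => y 0 != y 1 := by
    have := C.pred_mem
    simpa [maxCutPreds] using this
  simp [CSPConstraint.sat, h]

/-- the weighting of ORDERED pairs read off a tree instance: `w i j = #{c : idx c = (i, j)} / M`. -/
noncomputable def instWeight {n : ℕ} (I : CSPInstance 2 n maxCutPreds) : Fin n → Fin n → ℝ :=
  fun i j => (∑ c : Fin I.M, if (I.cons c).idx 0 = i ∧ (I.cons c).idx 1 = j then (1 : ℝ) else 0) / I.M

/-- instance weights are nonnegative. -/
theorem instWeight_nonneg {n : ℕ} (I : CSPInstance 2 n maxCutPreds) : ∀ i j, 0 ≤ instWeight I i j := by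
  intro i j
  unfold instWeight
  exact div_nonneg (Finset.sum_nonneg fun c _ => by split_ifs <;> norm_num) (Nat.cast_nonneg _)

/-- a double sum of an indicator of one pair picks out one term. -/
theorem sum_sum_ite_and_eq {n : ℕ} (f : Fin n → Fin n → ℝ) (i₀ j₀ : Fin n) :
    (∑ i, ∑ j, if i₀ = i ∧ j₀ = j then f i j else 0) = f i₀ j₀ := by
  have inner : ∀ i, (∑ j, if i₀ = i ∧ j₀ = j then f i j else 0) = if i₀ = i then f i j₀ else 0 := by
    intro i
    by_cases hi : i₀ = i <;> simp [hi]
  simp_rw [inner]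
  simp

/-- `cutValue (instWeight I) b = I.val b`. -/
theorem cutValue_instWeight {n : ℕ} (I : CSPInstance 2 n maxCutPreds) (b : Fin n → Bool) :
    cutValue (instWeight I) b = I.val b := by
  classical
  set g : Fin n → Fin n → ℝ := fun i j => if b i = b j then 0 else 1 with hg
  have hR : I.val b = (∑ c : Fin I.M, g ((I.cons c).idx 0) ((I.cons c).idx 1)) / I.M := by
    unfold CSPInstance.val
    congr 1
    refine Finset.sum_congr rfl fun c _ => ?_
    rw [sat_eq_bne]
    by_cases hc : b ((I.cons c).idx 0) = b ((I.cons c).idx 1)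
    · simp [hg, hc]
    · simp [hg, hc]
  have h1 : ∀ i j, (if b i = b j then (0 : ℝ) else
        (∑ c : Fin I.M, if (I.cons c).idx 0 = i ∧ (I.cons c).idx 1 = j then (1 : ℝ) else 0) / I.M) =
      (∑ c : Fin I.M, if (I.cons c).idx 0 = i ∧ (I.cons c).idx 1 = j then g i j else 0) / I.M := by
    intro i j
    by_cases hij : b i = b j
    · simp [hij, hg]
    · simp [hij, hg]
  have hL : cutValue (instWeight I) b =
      (∑ i, ∑ j, ∑ c : Fin I.M, if (I.cons c).idx 0 = i ∧ (I.cons c).idx 1 = j then g i j else 0) / I.M := by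
    unfold cutValue instWeight
    simp_rw [h1]
    simp only [← Finset.sum_div]
  rw [hL, hR]
  congr 1
  calc (∑ i, ∑ j, ∑ c : Fin I.M, if (I.cons c).idx 0 = i ∧ (I.cons c).idx 1 = j then g i j else 0)
      = ∑ i, ∑ c : Fin I.M, ∑ j, (if (I.cons c).idx 0 = i ∧ (I.cons c).idx 1 = j then g i j else 0) :=
        Finset.sum_congr rfl fun i _ => Finset.sum_comm
    _ = ∑ c : Fin I.M, ∑ i, ∑ j, (if (I.cons c).idx 0 = i ∧ (I.cons c).idx 1 = j then g i j else 0) :=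
        Finset.sum_comm
    _ = ∑ c : Fin I.M, g ((I.cons c).idx 0) ((I.cons c).idx 1) :=
        Finset.sum_congr rfl fun c _ => sum_sum_ite_and_eq g _ _

/-- `maxCutValue (instWeight I) = I.opt`. -/
theorem maxCutValue_instWeight {n : ℕ} (I : CSPInstance 2 n maxCutPreds) : maxCutValue (instWeight I) = I.opt := by
  unfold maxCutValue CSPInstance.opt
  exact Finset.sup'_congr _ rfl fun b _ => cutValue_instWeight I b

/-! ### §6b the asymptotic bookkeeping: `2^{n^{c₃}} ≤ 3R + 2n² + 4 ⟹ 2^{n^{c₃/2}} ≤ R` eventually -/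

/-- `a ^ (k : ℝ) = a ^ k`. -/
theorem rpow_nat_eq (a : ℝ) (k : ℕ) : a ^ ((k : ℕ) : ℝ) = a ^ k := Real.rpow_natCast a k

/-- for `n` large (in terms of `c₃ > 0`): if `2^{n^{c₃}} ≤ 3R + 2n² + 4` then `2^{n^{c₃/2}} ≤ R`. -/
theorem two_rpow_half_le_of_bound {c₃ : ℝ} (hc₃ : 0 < c₃) :
    ∃ n₁ : ℕ, ∀ n ≥ n₁, ∀ R : ℕ,
      (2 : ℝ) ^ ((n : ℝ) ^ c₃) ≤ 3 * (R : ℝ) + 2 * (n : ℝ) ^ 2 + 4 → (2 : ℝ) ^ ((n : ℝ) ^ (c₃ / 2)) ≤ R := by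
  have hc : 0 < c₃ / 2 := by positivity
  obtain ⟨h₀, hh₀⟩ := CorSandwich.polylog_lt_rpow_eventually 1 hc
  refine ⟨max h₀ 8, fun n hn R hB => ?_⟩
  have hn0 : h₀ ≤ n := le_trans (le_max_left _ _) hn
  have hn8 : 8 ≤ n := le_trans (le_max_right _ _) hn
  set x : ℝ := (n : ℝ) ^ (c₃ / 2) with hx
  set y : ℝ := (2 : ℝ) ^ x with hy
  -- `log₂ n + 1 < x`, hence `4 ≤ x` (as `n ≥ 8`) and `n < 2^x = y`
  have hlog : (((Nat.log 2 n + 1 : ℕ)) : ℝ) < x := by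
    have := hh₀ n hn0
    simpa using this
  have hk3 : 3 ≤ Nat.log 2 n := Nat.le_log_of_pow_le (by norm_num) (by simpa using hn8)
  have hx4 : 4 ≤ x := by
    have h4 : ((4 : ℕ) : ℝ) ≤ ((Nat.log 2 n + 1 : ℕ) : ℝ) := by exact_mod_cast (by omega : 4 ≤ Nat.log 2 n + 1)
    have hlog' := hlog
    push_cast at h4 hlog' ⊢
    linarith
  have hx0 : 0 ≤ x := by linarith
  have hny : (n : ℝ) < y := by
    have h1 : n < 2 ^ (Nat.log 2 n + 1) := Nat.lt_pow_succ_log_self (by norm_num) n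
    have h2 : (n : ℝ) < (2 : ℝ) ^ (((Nat.log 2 n + 1 : ℕ)) : ℝ) := by
      rw [rpow_nat_eq]; exact_mod_cast h1
    exact h2.trans (Real.rpow_lt_rpow_of_exponent_lt one_lt_two hlog)
  have hy16 : 16 ≤ y := by
    have h := Real.rpow_le_rpow_of_exponent_le one_le_two hx4
    have h4 : (2 : ℝ) ^ (4 : ℝ) = 16 := by
      rw [show (4 : ℝ) = ((4 : ℕ) : ℝ) by norm_num, rpow_nat_eq]; norm_num
    rw [h4] at h
    exact h
  have hn2 : (n : ℝ) ^ 2 < y ^ 2 := by nlinarith [hny, Nat.cast_nonneg (α := ℝ) n]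
  -- the exponent algebra: `8 y² = 2^{2x+3} ≤ 2^{x²} = 2^{n^{c₃}}`
  have hy2 : y ^ 2 = (2 : ℝ) ^ (2 * x) := by
    rw [hy, mul_comm, Real.rpow_mul (by norm_num : (0 : ℝ) ≤ 2), Real.rpow_two]
  have h8y2 : 8 * y ^ 2 = (2 : ℝ) ^ (2 * x + 3) := by
    rw [Real.rpow_add (by norm_num : (0 : ℝ) < 2), ← hy2,
      show (3 : ℝ) = ((3 : ℕ) : ℝ) by norm_num, rpow_nat_eq]
    norm_num; ring
  have hx2 : x ^ 2 = (n : ℝ) ^ c₃ := by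
    rw [hx, ← Real.rpow_two, ← Real.rpow_mul (Nat.cast_nonneg n)]
    congr 1; ring
  have hexp : 2 * x + 3 ≤ x ^ 2 := by nlinarith [hx4]
  have htop : (2 : ℝ) ^ (2 * x + 3) ≤ (2 : ℝ) ^ ((n : ℝ) ^ c₃) := by
    rw [← hx2]; exact Real.rpow_le_rpow_of_exponent_le one_le_two hexp
  -- contradiction if `R < y`
  by_contra hR
  push Not at hR
  have hlt : 3 * (R : ℝ) + 2 * (n : ℝ) ^ 2 + 4 < 8 * y ^ 2 := by nlinarith [hR, hn2, hy16]
  linarith [hB, hlt, h8y2 ▸ htop]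

/-! ### §6c the bridge theorem -/

/-- ★★★ **`KMR.MaxCutLPGapHard` HOLDS** — from the tree theorem `KothariMekaRaghavendra2017_cor15_maxCut_holds` th … ⟨abr.⟩ -/
theorem maxCutLPGapHard_holds : MaxCutLPGapHard := by
  intro ε hε
  obtain ⟨c₃, hc₃, n₀, hn₀⟩ := KothariMekaRaghavendra2017_cor15_maxCut_holds (ε / 2) (by linarith)
  obtain ⟨n₁, hn₁⟩ := two_rpow_half_le_of_bound hc₃
  refine ⟨c₃ / 2, by positivity, max n₀ n₁, fun n hn D _ L R hG hS => ?_⟩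
  classical
  have hn0 : n₀ ≤ n := le_trans (le_max_left _ _) hn
  have hn1 : n₁ ≤ n := le_trans (le_max_right _ _) hn
  -- the size-`R` slack-form lift of the feasible region and one slack vector per cut
  obtain ⟨Q, hQ⟩ := hS
  have hsl : ∀ b : Fin n → Bool, ∃ y : Fin R → ℝ, (∀ j, 0 ≤ y j) ∧ Q.E *ᵥ L.pt b + Q.F *ᵥ y = Q.g := by
    intro b
    have hb : L.pt b ∈ Q.projSet := by rw [hQ]; exact L.contains b
    exact hb
  choose ys hys0 hysE using hsl
  obtain ⟨V, hV, hVdef⟩ : ∃ V : Fin R → (Fin n → Bool) → ℝ, (∀ l b, 0 ≤ V l b) ∧ ∀ l b, V l b = ys b l :=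
    ⟨fun l b => ys b l, fun l b => hys0 b l, fun l b => rfl⟩
  have hne : Q.projSet.Nonempty := ⟨L.pt fun _ => false, by rw [hQ]; exact L.contains _⟩
  -- per instance: a nonnegative factorisation of `c' − I.val` through the slack coordinates, `c' ≤ (2−ε)·opt`
  have hcert : ∀ I : CSPInstance 2 n maxCutPreds, ∃ (c' : ℝ) (U : Fin R → ℝ),
      (∀ l, 0 ≤ U l) ∧ c' ≤ (2 - ε) * I.opt ∧ ∀ b, c' - I.val b = ∑ l, U l * V l b := by
    intro I
    have hwnn : ∀ i j, 0 ≤ instWeight I i j := instWeight_nonneg I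
    have hval : ∀ u ∈ Q.projSet, 0 ≤ (2 - ε) * maxCutValue (instWeight I) + (-L.obj (instWeight I)) ⬝ᵥ u := by
      intro u hu
      have hu' : u ∈ L.feasible := by rw [← hQ]; exact hu
      have := hG (instWeight I) hwnn u hu'
      rw [neg_dotProduct]; linarith
    obtain ⟨μ, hE, hF, hg⟩ :=
      liftCertificate Q (-L.obj (instWeight I)) _ hne hval
    refine ⟨-(μ ⬝ᵥ Q.g), fun l => -((μ ᵥ* Q.F) l), fun l => by linarith [hF l], ?_, fun b => ?_⟩
    · rw [maxCutValue_instWeight] at hg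
      linarith
    · have h1 : L.obj (instWeight I) ⬝ᵥ L.pt b = I.val b := by
        rw [L.consistent (instWeight I) hwnn b, cutValue_instWeight]
      have h2 : L.obj (instWeight I) ⬝ᵥ L.pt b = -(μ ⬝ᵥ (Q.E *ᵥ L.pt b)) := by
        have : L.obj (instWeight I) = -(μ ᵥ* Q.E) := by rw [← hE, neg_neg]
        rw [this, neg_dotProduct, Matrix.dotProduct_mulVec]
      have h3 : Q.E *ᵥ L.pt b = Q.g - Q.F *ᵥ ys b := by rw [← hysE b]; simp
      rw [h2, h3, dotProduct_sub, Matrix.dotProduct_mulVec] at h1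
      have h4 : (∑ l, -((μ ᵥ* Q.F) l) * V l b) = -((μ ᵥ* Q.F) ⬝ᵥ ys b) := by
        simp only [hVdef, dotProduct, neg_mul, Finset.sum_neg_distrib]
      rw [h4]
      linarith
  -- the CLRS relaxation of the tree built on `V` achieves ratio `2 − ε`, hence has gap `< 2 − ε/2`
  have hAR : (Literature.Combinatorics.Optimization.NnrLp.relaxation (k := 2) (P := maxCutPreds) (V := V) hV).AchievesRatio
      (2 - ε) := by
    intro I y hy
    have hfe : Literature.Combinatorics.Optimization.NnrLp.Feasible 2 V y := by
      intro ρ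
      have h : Literature.Combinatorics.Optimization.NnrLp.rowVec 2 V
            ((Literature.Combinatorics.Optimization.NnrLp.eR (k := 2) (V := V)).symm
              (Literature.Combinatorics.Optimization.NnrLp.eR (k := 2) (V := V) ρ)) ⬝ᵥ y ≤
          Literature.Combinatorics.Optimization.NnrLp.rhs 2 V
            ((Literature.Combinatorics.Optimization.NnrLp.eR (k := 2) (V := V)).symm
              (Literature.Combinatorics.Optimization.NnrLp.eR (k := 2) (V := V) ρ)) :=
        hy (Literature.Combinatorics.Optimization.NnrLp.eR (k := 2) (V := V) ρ)
      rwa [Equiv.symm_apply_apply] at h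
    obtain ⟨c', U, hU, hc', hfac⟩ := hcert I
    exact (hfe.val_le hU hfac).trans hc'
  have hGap : (Literature.Combinatorics.Optimization.NnrLp.relaxation (k := 2) (P := maxCutPreds) (V := V) hV).GapLT
      (2 - ε / 2) := ⟨2 - ε, by linarith, hAR⟩
  -- KMR Cor. 1.5 (tree) forces the CLRS relaxation to be large; its size is `≤ 3R + 2n² + 4`
  have hsize : (2 : ℝ) ^ ((n : ℝ) ^ c₃) ≤
      (Literature.Combinatorics.Optimization.NnrLp.size (k := 2) (V := V) : ℝ) := by
    by_contra hlt
    push Not at hlt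
    exact hn₀ n hn0 _ hlt _ hGap
  have hle : (Literature.Combinatorics.Optimization.NnrLp.size (k := 2) (V := V) : ℝ) ≤
      3 * (R : ℝ) + 2 * (n : ℝ) ^ 2 + 4 := by
    exact_mod_cast Literature.Combinatorics.Optimization.NnrLp.size_le (k := 2) (V := V)
  exact hn₁ n hn1 R (hsize.trans hle)

end KMR

end Unconditional

end Summit.ValiantsHypothesis.ValiantsHypothesis.Theorems.FifoMatching.MaxCutLP
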